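import Mathlib.LinearAlgebra.Dual.Lemmas
import Mathlib.Algebra.Field.ZMod
import Mathlib.GroupTheory.Subgroup.Center
import Mathlib.Algebra.BigOperators.Pi
import Mathlib.Tactic.Group
import Mathlib.Tactic.FinCases
import Mathlib.Tactic.Abel
import HarnessLib

/-!
# Route ConvexRankGates, crux `Capture` (stmt-PneNP-2659), line `csp-spine-meet-to-join`, Stub 3b:
# the CENTRAL CERTIFICATE lemma

The group-theoretic engine behind the capture of coset CSPs over class-2 2-groups (continuation lead c1,
2026-08-16). Let `P` be a group, `e : Multiplicative Zadd →* P` a homomorphism from an `𝔽₂`-vector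
space into the CENTRE of `P` (the central layer), `H j ≤ P` subgroups and `g j ∈ P` coset
representatives (`j ∈ ι`, the selected constraints). Suppose the quotient instance modulo the central
layer is solvable, witnessed by `x₀ = g j * p₀ j * e (ζ₀ j)` with `p₀ j ∈ H j` for every `j`, but the
instance itself is not: no `y` lies in every coset `g j • H j`. Then there is a CERTIFICATE: linear
functionals `θ j : Zadd →ₗ[ZMod 2] ZMod 2` such that (a) `θ j` kills the central elements of `H j`,
(b) `∑ j, θ j = 0` (the diagonal is killed), and (c) for EVERY lift `x = g j * p j * e (ζ j)`
(`p j ∈ H j`) of every solution of the quotient instance, `∑ j, θ j (ζ j) = 1`.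

Proof: in the `𝔽₂`-space `ι → Zadd` the decomposition vectors of the elements of `⋂ j, H j · e(Zadd)`
form a submodule `Gen` (products of lifts decompose coordinatewise — the obstruction map is a
HOMOMORPHISM because the layer is central), `K = {t | ∃ z, ∀ j, e (t j + z) ∈ H j}` is a submodule,
unsolvability says `ζ₀ ∉ Gen ⊔ K`, and a linear functional separating `ζ₀` from `Gen ⊔ K`
(`Submodule.exists_dual_map_eq_bot_of_notMem`) is the certificate. With it, emptiness of an
intersection of selected cosets (a MEET) becomes an `𝔽₂`-linear condition on the lifts of the quotient
solutions — the step that turns coset CSPs over `D₄`, `Q₈`, extraspecial 2-groups, … into ONE LIN gate.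
[folklore]
-/

namespace Summit.PneNP.PneNP.Cruxes.Capture.CspSpineMeetToJoin

set_option linter.dupNamespace false -- `Summit.PneNP.PneNP.…`: summit = sub-problem (D-0017)

open Multiplicative

/-- **Central certificate lemma** (binder form). `e` maps an `𝔽₂`-vector space into the centre of `P`;
the quotient instance is solvable through `x₀ = g j * p₀ j * e (ζ₀ j)` (`p₀ j ∈ H j`) but
`⋂ j, g j • H j = ∅`. Then some linear functionals `θ j` kill the central parts of the `H j`, sum to
zero, and sum to `1` on the decomposition vector of every lift of every solution of the quotient
instance. [folklore] -/
theorem central_certificate' {P : Type*} [Group P] {Zadd : Type*} [AddCommGroup Zadd]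
    [Module (ZMod 2) Zadd] (e : Multiplicative Zadd →* P) {ι : Type*} [Fintype ι] [DecidableEq ι]
    (H : ι → Subgroup P) (hcen : ∀ z, e z ∈ Subgroup.center P)
    (g : ι → P) (x₀ : P) (p₀ : ι → P) (ζ₀ : ι → Zadd) (hp₀ : ∀ j, p₀ j ∈ H j)
    (hx₀ : ∀ j, x₀ = g j * p₀ j * e (ofAdd (ζ₀ j)))
    (hunsat : ¬ ∃ y : P, ∀ j, (g j)⁻¹ * y ∈ H j) :
    ∃ θ : ι → (Zadd →ₗ[ZMod 2] ZMod 2),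
      (∀ j (ζ : Zadd), e (ofAdd ζ) ∈ H j → θ j ζ = 0) ∧
      (∀ ζ : Zadd, ∑ j, θ j ζ = 0) ∧
      ∀ (x : P) (p : ι → P) (ζ : ι → Zadd), (∀ j, p j ∈ H j) →
        (∀ j, x = g j * p j * e (ofAdd (ζ j))) → ∑ j, θ j (ζ j) = 1 := by
  classical
  have zmod2 : ∀ c : ZMod 2, c = 0 ∨ c = 1 := by decide
  haveI : Fact (Nat.Prime 2) := ⟨Nat.prime_two⟩
  -- `Gen`: decomposition vectors of the elements of `⋂ j, H j · e(Zadd)`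
  let Gen : Submodule (ZMod 2) (ι → Zadd) :=
    { carrier := {t | ∃ w : P, ∃ p : ι → P, (∀ j, p j ∈ H j) ∧ ∀ j, w = p j * e (ofAdd (t j))}
      zero_mem' := ⟨1, fun _ => 1, fun j => (H j).one_mem, fun j => by simp⟩
      add_mem' := by
        rintro t t' ⟨w, p, hp, hw⟩ ⟨w', p', hp', hw'⟩
        refine ⟨w * w', fun j => p j * p' j, fun j => (H j).mul_mem (hp j) (hp' j), fun j => ?_⟩
        have hc : e (ofAdd (t j)) * p' j = p' j * e (ofAdd (t j)) :=
          ((Subgroup.mem_center_iff.1 (hcen (ofAdd (t j)))) (p' j)).symm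
        calc w * w' = p j * e (ofAdd (t j)) * (p' j * e (ofAdd (t' j))) := by rw [hw j, hw' j]
          _ = p j * (e (ofAdd (t j)) * p' j) * e (ofAdd (t' j)) := by group
          _ = p j * (p' j * e (ofAdd (t j))) * e (ofAdd (t' j)) := by rw [hc]
          _ = p j * p' j * (e (ofAdd (t j)) * e (ofAdd (t' j))) := by group
          _ = p j * p' j * e (ofAdd ((t + t') j)) := by rw [← map_mul, ← ofAdd_add, Pi.add_apply]
      smul_mem' := by
        rintro c t ht
        rcases zmod2 c with rfl | rfl
        · rw [zero_smul]
          exact ⟨1, fun _ => 1, fun j => (H j).one_mem, fun j => by simp⟩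
        · rw [one_smul]; exact ht }
  -- `K`: the diagonal plus the central parts of the `H j`
  let K : Submodule (ZMod 2) (ι → Zadd) :=
    { carrier := {t | ∃ z : Zadd, ∀ j, e (ofAdd (t j + z)) ∈ H j}
      zero_mem' := ⟨0, fun j => by simp [(H j).one_mem]⟩
      add_mem' := by
        rintro t t' ⟨z, hz⟩ ⟨z', hz'⟩
        refine ⟨z + z', fun j => ?_⟩
        have := (H j).mul_mem (hz j) (hz' j)
        rw [← map_mul, ← ofAdd_add] at this
        convert this using 3
        simp only [Pi.add_apply]; abel
      smul_mem' := by
        rintro c t ⟨z, hz⟩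
        rcases zmod2 c with rfl | rfl
        · exact ⟨0, fun j => by simp [(H j).one_mem]⟩
        · exact ⟨z, fun j => by simpa using hz j⟩ }
  set W : Submodule (ZMod 2) (ι → Zadd) := Gen ⊔ K with hW
  -- unsolvability keeps `ζ₀` out of `W`
  have hζ₀ : ζ₀ ∉ W := by
    intro hmem
    rw [Submodule.mem_sup] at hmem
    obtain ⟨t, ⟨w, p, hp, hw⟩, κ, ⟨z, hz⟩, htk⟩ := hmem
    apply hunsat
    refine ⟨x₀ * w⁻¹ * e (ofAdd z), fun j => ?_⟩
    have hζ : ζ₀ j = t j + κ j := by rw [← htk]; rfl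
    have hcw : w * e (ofAdd (κ j)) = e (ofAdd (κ j)) * w :=
      (Subgroup.mem_center_iff.1 (hcen (ofAdd (κ j)))) w
    have hx : x₀ = g j * p₀ j * (p j)⁻¹ * e (ofAdd (κ j)) * w := by
      have hw' : e (ofAdd (t j)) = (p j)⁻¹ * w := by rw [hw j]; group
      calc x₀ = g j * p₀ j * e (ofAdd (ζ₀ j)) := hx₀ j
        _ = g j * p₀ j * (e (ofAdd (t j)) * e (ofAdd (κ j))) := by
            rw [hζ, ofAdd_add, map_mul]
        _ = g j * p₀ j * ((p j)⁻¹ * w * e (ofAdd (κ j))) := by rw [hw']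
        _ = g j * p₀ j * ((p j)⁻¹ * (e (ofAdd (κ j)) * w)) := by rw [mul_assoc ((p j)⁻¹), hcw]
        _ = g j * p₀ j * (p j)⁻¹ * e (ofAdd (κ j)) * w := by group
    have : (g j)⁻¹ * (x₀ * w⁻¹ * e (ofAdd z)) = p₀ j * (p j)⁻¹ * e (ofAdd (κ j + z)) := by
      rw [hx, ofAdd_add, map_mul]; group
    rw [this]
    exact (H j).mul_mem ((H j).mul_mem (hp₀ j) ((H j).inv_mem (hp j))) (hz j)
  -- separate `ζ₀` from `W` by a linear functional
  haveI : Module.Free (ZMod 2) ((ι → Zadd) ⧸ W) :=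
    Module.Free.of_divisionRing (ZMod 2) ((ι → Zadd) ⧸ W)
  obtain ⟨f, hf0, hfW⟩ := Submodule.exists_dual_map_eq_bot_of_notMem hζ₀ Module.Projective.of_free
  have hfW' : ∀ t ∈ W, f t = 0 := fun t ht => by
    have : f t ∈ W.map f := Submodule.mem_map_of_mem ht
    rwa [hfW, Submodule.mem_bot] at this
  have hf1 : f ζ₀ = 1 := by
    rcases zmod2 (f ζ₀) with h | h
    · exact absurd h hf0
    · exact h
  refine ⟨fun j => f.comp (LinearMap.single (ZMod 2) (fun _ : ι => Zadd) j), ?_, ?_, ?_⟩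
  · -- (a) central elements of `H j` are killed: `single j ζ ∈ K ⊆ W`
    intro j ζ hζ
    refine hfW' _ (Submodule.mem_sup_right ⟨0, fun i => ?_⟩)
    by_cases hij : i = j
    · subst hij; simpa using hζ
    · simp [Pi.single_eq_of_ne hij, (H i).one_mem]
  · -- (b) the diagonal is killed: `(fun _ => ζ) ∈ K ⊆ W` with `z = ζ` (`ζ + ζ = 0`)
    intro ζ
    have hsum : ∑ j, f.comp (LinearMap.single (ZMod 2) (fun _ : ι => Zadd) j) ζ =
        f (∑ j, Pi.single j ζ) := by
      rw [map_sum]; rfl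
    rw [hsum, Finset.univ_sum_single]
    refine hfW' _ (Submodule.mem_sup_right ⟨ζ, fun j => ?_⟩)
    have h2 : ζ + ζ = 0 := by
      have := (two_smul (ZMod 2) ζ).symm
      rwa [show (2 : ZMod 2) = 0 from rfl, zero_smul] at this
    simp [h2, (H j).one_mem]
  · -- (c) every lift of every solution of the quotient instance: `ζ - ζ₀ ∈ Gen ⊆ W`
    intro x p ζ hp hx
    have hsum : ∑ j, f.comp (LinearMap.single (ZMod 2) (fun _ : ι => Zadd) j) (ζ j) = f ζ := by
      rw [show f ζ = f (∑ j, Pi.single j (ζ j)) by rw [Finset.univ_sum_single ζ], map_sum]; rfl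
    rw [hsum]
    have hgen : ζ - ζ₀ ∈ W := by
      refine Submodule.mem_sup_left ⟨x₀⁻¹ * x, fun j => (p₀ j)⁻¹ * p j,
        fun j => (H j).mul_mem ((H j).inv_mem (hp₀ j)) (hp j), fun j => ?_⟩
      have hc : (e (ofAdd (ζ₀ j)))⁻¹ * ((p₀ j)⁻¹ * p j) = (p₀ j)⁻¹ * p j * (e (ofAdd (ζ₀ j)))⁻¹ :=
        ((Subgroup.mem_center_iff.1 ((Subgroup.center P).inv_mem (hcen (ofAdd (ζ₀ j)))))
          ((p₀ j)⁻¹ * p j)).symm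
      have hE : (e (ofAdd (ζ₀ j)))⁻¹ * e (ofAdd (ζ j)) = e (ofAdd ((ζ - ζ₀) j)) := by
        rw [← map_inv, ← map_mul, ← ofAdd_neg, ← ofAdd_add, Pi.sub_apply, neg_add_eq_sub]
      calc x₀⁻¹ * x = (g j * p₀ j * e (ofAdd (ζ₀ j)))⁻¹ * (g j * p j * e (ofAdd (ζ j))) := by
            rw [← hx₀ j, ← hx j]
        _ = (e (ofAdd (ζ₀ j)))⁻¹ * ((p₀ j)⁻¹ * p j) * e (ofAdd (ζ j)) := by group
        _ = (p₀ j)⁻¹ * p j * (e (ofAdd (ζ₀ j)))⁻¹ * e (ofAdd (ζ j)) := by rw [hc]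
        _ = (p₀ j)⁻¹ * p j * e (ofAdd ((ζ - ζ₀) j)) := by rw [mul_assoc, hE]
    have : f ζ = f ζ₀ + f (ζ - ζ₀) := by rw [← map_add]; congr 1; abel
    rw [this, hf1, hfW' _ hgen, add_zero]

/-- **Central certificate lemma** (registered sub-goal `central_certificate` of stmt-PneNP-2659, stated
as one closed proposition): see `central_certificate'`. [folklore] -/
theorem central_certificate : ∀ {P : Type*} [Group P] {Zadd : Type*} [AddCommGroup Zadd]
    [Module (ZMod 2) Zadd] (e : Multiplicative Zadd →* P) {ι : Type*} [Fintype ι] [DecidableEq ι]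
    (H : ι → Subgroup P), (∀ z, e z ∈ Subgroup.center P) → ∀ (g : ι → P) (x₀ : P) (p₀ : ι → P)
    (ζ₀ : ι → Zadd), (∀ j, p₀ j ∈ H j) → (∀ j, x₀ = g j * p₀ j * e (Multiplicative.ofAdd (ζ₀ j))) →
    (¬ ∃ y : P, ∀ j, (g j)⁻¹ * y ∈ H j) → ∃ θ : ι → (Zadd →ₗ[ZMod 2] ZMod 2),
    (∀ j (ζ : Zadd), e (Multiplicative.ofAdd ζ) ∈ H j → θ j ζ = 0) ∧ (∀ ζ : Zadd, ∑ j, θ j ζ = 0) ∧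
    ∀ (x : P) (p : ι → P) (ζ : ι → Zadd), (∀ j, p j ∈ H j) →
    (∀ j, x = g j * p j * e (Multiplicative.ofAdd (ζ j))) → ∑ j, θ j (ζ j) = 1 :=
  fun e _ _ _ H hcen g x₀ p₀ ζ₀ hp₀ hx₀ hunsat =>
    central_certificate' e H hcen g x₀ p₀ ζ₀ hp₀ hx₀ hunsat

end Summit.PneNP.PneNP.Cruxes.Capture.CspSpineMeetToJoin
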